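import Summits.BirchSwinnertonDyer.BirchSwinnertonDyer.Theorems.UniversalToricDescentAcDualMuZeroCriterion
import Summits.BirchSwinnertonDyer.BirchSwinnertonDyer.Theorems.IwasawaTwistedCoinvariantsNoFiniteSubmodule
import Literature.NumberTheory.EllipticCurves.IwasawaTwistedInvariantsFiniteProofs
import HarnessLib

/-!
# Route UniversalToricDescent — Greenberg's twist on Castella's Selmer group: generic finiteness of the
# `u`-eigenvectors of `conj_γ` on `Sel_𝔭^Σ(K_∞, E[p^∞])`, and «twisted coinvariants `0` ⟹ (N1)» for `X_ac^Σ`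

Lead prover bsd-wall-utd-p1 g14 (`--supports` ♭T′ stmt-BirchSwinnertonDyer-26975; line `sigmacongruence` v3, the twin stubs TS1–TS3
via Greenberg's twisted descent, LNM 1716 Prop. 4.13–4.15). Two one-step instances of the tree's dual-pair algebra
(`Literature/…/IwasawaTwistedInvariantsFiniteProofs`, `…/IwasawaTwistedCoinvariantsNoFiniteSubmodule`) on the dual pair
`(X_ac^Σ(E[p^∞]), Sel_𝔭^Σ(K_∞, E[p^∞]))` (`XAc.isDualPair`):

* §1 `finite_setOf_int_infinite_conjH1_eq_zsmul` — if `Σ` is finite and `Sel_𝔭^Σ[p]` is finite (so `X_ac^Σ` is f.g. and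
  `Λ`-torsion), the set of `u ≡ 1 (mod p)` whose eigenspace `{s ∈ Sel_𝔭^Σ : conj_γ s = u·s}` (= `(Sel ⊗ χ_u⁻¹)^Γ`) is
  infinite is FINITE (Greenberg p. 124 «finite for all but finitely many `s`»); `exists_pow_nsmul_eq_zero_of_conjH1_eq_zsmul`
  — for every other `u` one exponent `p^a` kills that eigenspace (the `hS` input of
  `WeierstrassCurve.pow_smul_eq_zero_of_twistedTorsionToH1_mem`, the dual-side control of the twisted Poitou–Tate lift);
* §2 `XAc.forall_finite_eq_bot_of_twistedCoinvariants` — if `conj_γ − (1+c)` is ONTO `Sel_𝔭^Σ` for one `c` with `p ∣ c`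
  (the `(1+c)`-twisted `Γ`-coinvariants vanish), then `X_ac^Σ` has no non-zero finite `Λ`-submodule (stub TS3's last step).

HONEST STATUS: helper theorems (pure algebra on landed objects); the twisted coinvariants / eigenvector inputs are hypotheses.
THEOREMS ONLY; no definition, no named fact, no `sorry`. BSD is not advanced by this file.
References: [GreenbergLNM1716] §4 pp. 104–107, 123–125; [Castella2018] §2.2; [Washington1997] §13.2.
-/

set_option autoImplicit false
-- `…BirchSwinnertonDyer.BirchSwinnertonDyer.Theorems…` is the problem's mandated namespace (D-0017).
set_option linter.dupNamespace false

noncomputable section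
open scoped Classical

namespace Summit.BirchSwinnertonDyer.BirchSwinnertonDyer.Theorems.UniversalToricDescentTwistedDescent

open Function Field NumberField IsDedekindDomain WeierstrassCurve
open Literature.NumberTheory.GaloisRepresentations Literature.NumberTheory.EllipticCurves
  Literature.NumberTheory.EllipticCurves.GreenbergSelmer Literature.NumberTheory.EllipticCurves.IwasawaAlgebra
  Summit.BirchSwinnertonDyer.Rank1Residual Summit.BirchSwinnertonDyer.Rank1Residual.X11b
  Summit.BirchSwinnertonDyer.Rank1Residual.X11b.AcSelmer
  Summit.BirchSwinnertonDyer.BirchSwinnertonDyer.Theorems.UniversalToricDescentAcDualMuZero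

variable {K : Type} [Field K] [NumberField K] (W : WeierstrassCurve K) [W.IsElliptic] (p : ℕ) [Fact p.Prime]
  (κ : ZpExtension K p) (𝔭 : HeightOneSpectrum (𝓞 K)) (S : Set (HeightOneSpectrum (𝓞 K)))
  (γ : absoluteGaloisGroup K) [hγ : Fact (κ.IsTopGenerator γ)]

/-! ### §1 Generic finiteness of the `u`-eigenvectors of `conj_γ` -/

/-- **For all but finitely many `u ≡ 1 (mod p)` the eigenspace `{s ∈ Sel_𝔭^Σ(K_∞, E[p^∞]) : conj_γ s = u·s}` is finite**
(`Σ` finite, `Sel_𝔭^Σ[p]` finite ⟹ `X_ac^Σ` finitely generated and `Λ`-torsion; the eigenspace is dual to `X/(T − (u−1))X`).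
[cite: GreenbergLNM1716, §4 pp. 123–124 («`S_{A_s}(F_∞)^Γ` … finite for all but finitely many `s`»)] -/
theorem finite_setOf_int_infinite_conjH1_eq_zsmul (hS : S.Finite)
    (hfin : Set.Finite {s : selmerAc W p κ 𝔭 S | p • s = 0}) :
    {u : ℤ | (p : ℤ) ∣ u - 1 ∧ {s : selmerAc W p κ 𝔭 S |
      W.conjH1 p κ.kerSubgroup γ (s : W.subgroupH1 p κ.kerSubgroup) =
        u • (s : W.subgroupH1 p κ.kerSubgroup)}.Infinite}.Finite := by
  haveI := XAc.module_finite κ 𝔭 S γ hS (W := W)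
  have hX : Module.IsTorsion (IwasawaAlgebra p) (XAc W p κ 𝔭 S γ) := isTorsion_of_finite_pTorsion W p κ 𝔭 S γ hS hfin
  have hD := XAc.isDualPair W p κ 𝔭 S γ
  have htor : ∀ s : selmerAc W p κ 𝔭 S, ∃ k : ℕ, p ^ k • s = 0 := selmerAc_exists_pow_smul_eq_zero W p κ 𝔭 S
  have hT : ∀ (x : XAc W p κ 𝔭 S γ) (s : selmerAc W p κ 𝔭 S),
      (AddMonoidHom.id (XAc W p κ 𝔭 S γ)) ((PowerSeries.X : IwasawaAlgebra p) • x) s =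
        (AddMonoidHom.id (XAc W p κ 𝔭 S γ)) x (conjSelmerAc W p κ 𝔭 S γ s) -
          (AddMonoidHom.id (XAc W p κ 𝔭 S γ)) x s := fun x s ↦ by
    show ((PowerSeries.X : IwasawaAlgebra p) • x) s = x (conjSelmerAc W p κ 𝔭 S γ s) - x s
    exact XAc.X_smul_apply W p κ 𝔭 S γ x s
  have h := IwasawaDual.finite_setOf_int_infinite_fixedBy (X := XAc W p κ 𝔭 S γ) (S := selmerAc W p κ 𝔭 S)
    (conjSelmerAc W p κ 𝔭 S γ) (AddMonoidHom.id (XAc W p κ 𝔭 S γ)) hX htor hT hD.C_smul hD.bijective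
  refine h.subset ?_
  rintro u ⟨hu, hinf⟩
  refine ⟨hu, fun hfin' ↦ hinf (hfin'.subset fun s hs ↦ ?_)⟩
  have hs' : W.conjH1 p κ.kerSubgroup γ (s : W.subgroupH1 p κ.kerSubgroup) =
      u • (s : W.subgroupH1 p κ.kerSubgroup) := hs
  change conjSelmerAc W p κ 𝔭 S γ s = u • s
  exact Subtype.ext (by rw [coe_conjSelmerAc_apply, AddSubgroupClass.coe_zsmul]; exact hs')

omit [W.IsElliptic] hγ in
/-- **A uniform killing exponent for a finite eigenspace**: if `{s ∈ Sel_𝔭^Σ : conj_γ s = u·s}` is finite then some `p^a`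
kills every `u`-eigenvector (`Sel` is `p`-primary). This is the hypothesis `hS` of
`WeierstrassCurve.pow_smul_eq_zero_of_twistedTorsionToH1_mem` for the subgroup `Sel_𝔭^Σ(K_∞, E[p^∞])`.
[cite: GreenbergLNM1716, §4 p. 123] -/
theorem exists_pow_nsmul_eq_zero_of_conjH1_eq_zsmul (u : ℤ)
    (hfinu : {s : selmerAc W p κ 𝔭 S |
      W.conjH1 p κ.kerSubgroup γ (s : W.subgroupH1 p κ.kerSubgroup) = u • (s : W.subgroupH1 p κ.kerSubgroup)}.Finite) :
    ∃ a : ℕ, ∀ s ∈ selmerAc W p κ 𝔭 S,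
      W.conjH1 p κ.kerSubgroup γ s = u • s → p ^ a • s = 0 := by
  -- one exponent per eigenvector, then the maximum over the finite eigenspace
  have hk : ∀ s : selmerAc W p κ 𝔭 S, ∃ k : ℕ, p ^ k • s = 0 := selmerAc_exists_pow_smul_eq_zero W p κ 𝔭 S
  choose k hk using hk
  refine ⟨hfinu.toFinset.sup k, fun s hs hsu ↦ ?_⟩
  have hmem : (⟨s, hs⟩ : selmerAc W p κ 𝔭 S) ∈ hfinu.toFinset := by
    rw [Set.Finite.mem_toFinset]; exact hsu
  have hle : k ⟨s, hs⟩ ≤ hfinu.toFinset.sup k := Finset.le_sup hmem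
  have h0 : p ^ (hfinu.toFinset.sup k) • (⟨s, hs⟩ : selmerAc W p κ 𝔭 S) = 0 := by
    rw [← Nat.sub_add_cancel hle, pow_add, mul_smul, hk, smul_zero]
  have h0' := congrArg Subtype.val h0
  rwa [AddSubmonoidClass.coe_nsmul] at h0'

/-- **§1 packaged: for all but finitely many `u ≡ 1 (mod p)`, one `p^a` kills every `u`-eigenvector of `conj_γ` on
`Sel_𝔭^Σ(K_∞, E[p^∞])`** (`Σ` finite, `Sel_𝔭^Σ[p]` finite). [cite: GreenbergLNM1716, §4 pp. 123–124] -/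
theorem finite_setOf_int_not_exists_pow (hS : S.Finite) (hfin : Set.Finite {s : selmerAc W p κ 𝔭 S | p • s = 0}) :
    {u : ℤ | (p : ℤ) ∣ u - 1 ∧ ¬ ∃ a : ℕ, ∀ s ∈ selmerAc W p κ 𝔭 S,
      W.conjH1 p κ.kerSubgroup γ s = u • s → p ^ a • s = 0}.Finite := by
  refine (finite_setOf_int_infinite_conjH1_eq_zsmul W p κ 𝔭 S γ hS hfin).subset ?_
  rintro u ⟨hu, hne⟩
  refine ⟨hu, ?_⟩
  by_contra hfinu
  exact hne (exists_pow_nsmul_eq_zero_of_conjH1_eq_zsmul W p κ 𝔭 S γ u (Set.not_infinite.mp hfinu))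

/-! ### §2 Twisted coinvariants `0` ⟹ no non-zero finite `Λ`-submodule of `X_ac^Σ` -/

omit [W.IsElliptic] in
/-- **If `conj_γ − (1+c)` is ONTO `Sel_𝔭^Σ(K_∞, E[p^∞])` for one `c` with `p ∣ c`, then `X_ac^Σ(E[p^∞])` has no non-zero
finite `Λ`-submodule** — Greenberg's last step («`S_M(F_∞)_Γ = 0` … hence no proper `Λ`-submodule of finite index») on
Castella's object: `T − c ∈ 𝔪_Λ` acts injectively on `X` (tree `TwistedCoinvariants.forall_finite_eq_bot_of_sub_nsmul_surjective` for
the dual pair `XAc.isDualPair`). [cite: GreenbergLNM1716, §4 Prop. 4.14–4.15 (pp. 123–125)] -/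
theorem XAc.forall_finite_eq_bot_of_twistedCoinvariants {c : ℕ} (hc : p ∣ c)
    (hsurj : ∀ s : selmerAc W p κ 𝔭 S, ∃ t : selmerAc W p κ 𝔭 S,
      W.conjH1 p κ.kerSubgroup γ (t : W.subgroupH1 p κ.kerSubgroup) - (1 + c) • (t : W.subgroupH1 p κ.kerSubgroup) = s) :
    ∀ N : Submodule (IwasawaAlgebra p) (XAc W p κ 𝔭 S γ), Finite N → N = ⊥ := by
  refine TwistedCoinvariants.forall_finite_eq_bot_of_sub_nsmul_surjective p (XAc.isDualPair W p κ 𝔭 S γ) hc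
    fun s ↦ ?_
  obtain ⟨t, ht⟩ := hsurj s
  refine ⟨t, Subtype.ext ?_⟩
  rw [AddSubgroupClass.coe_sub, IwasawaDual.End_sub_apply, AddMonoid.End.one_apply, AddSubgroupClass.coe_sub,
    coe_conjSelmerAc_apply, AddSubmonoidClass.coe_nsmul, ← ht, add_smul, one_smul]
  abel

end Summit.BirchSwinnertonDyer.BirchSwinnertonDyer.Theorems.UniversalToricDescentTwistedDescent

end
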